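import Literature.Probability.Distributions.PseudoGaussianSamplerDiscreteGaussian
import Literature.Probability.Distributions.PseudoGaussianSamplerParams
import Mathlib.Analysis.Complex.ExponentialBounds
import HarnessLib

/-!
# The pseudo-Gaussian sampler at the standard parameters is `20·2^{-m}`-close to the discrete Gaussian `D_{ℤ, 2ᵇ√π, 0}`

Topic `Probability/Distributions`; theorems only. `PseudoGaussianSamplerDiscreteGaussian.lean` bounds
`Δ(ℓ', D_{ℤ, s, 0})`, `s = √π/h = 2ᵇ√π`, for a general parameter set `P = (b, r, k, J)` by an explicit
expression in `q = 2^{-k}`, `R = 2^r`, `h = 2^{-b}`, `p₀^J`; `PseudoGaussianSamplerParams.lean` fixes the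
standard parameters `std m b = (b, rOf m, kOf m, JOf m)` and proves the smallness of these quantities
(`q R² = 2^{-(m+3)}`, `h ≤ 2^{-(m+1)}` for `b ≥ m + rOf m + 1`, `p₀^J ≤ 2^{-(m+1)}`, `R > m + 1`). This file
combines the two into the clean accuracy statement a machine analysis consumes:

* `exp_neg_R_std_le` — `e^{-R} ≤ 2^{-(m+1)}` (`R > m + 1`, `e ≥ 2`);
* **`tvDist_lawPMF_std_discreteGaussianInt_le`** — for `1 ≤ m` and `m + rOf m + 1 ≤ b`,
  `Δ((std m b).lawPMF, D_{ℤ, 2ᵇ√π, 0}) ≤ 20 · 2^{-m}`.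

## References

* C. Gentry, C. Peikert, V. Vaikuntanathan, *Trapdoors for hard lattices and new cryptographic
  constructions*, STOC 2008, §4.1 (sampling `D_{ℤ,s,c}` to within negligible statistical distance)
  [GentryPeikertVaikuntanathan2008].
-/

noncomputable section

namespace Literature.Probability.Distributions

open Real Literature.Algebra.EuclideanLattices

namespace PGParams

variable (m b : ℕ)

/-- `e^{-(k)} ≤ 2^{-k}` for naturals `k` (`e ≥ 2`). [folklore] -/
theorem exp_neg_nat_le (k : ℕ) : exp (-(k : ℝ)) ≤ ((2 : ℝ) ^ k)⁻¹ := by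
  have h2e : (2 : ℝ) ≤ exp 1 := le_of_lt (lt_trans (by norm_num) Real.exp_one_gt_d9)
  have heq : exp (-(k : ℝ)) = (exp 1 ^ k)⁻¹ := by
    rw [← Real.exp_nat_mul, mul_one, Real.exp_neg]
  rw [heq]
  exact inv_anti₀ (by positivity) (pow_le_pow_left₀ (by norm_num) h2e k)

/-- **`e^{-R} ≤ 2^{-(m+1)}`** at the standard parameters. [folklore] -/
theorem exp_neg_R_std_le : exp (-(std m b).R) ≤ ((2 : ℝ) ^ (m + 1))⁻¹ := by
  have hR := lt_R_std m b
  refine le_trans ?_ (exp_neg_nat_le (m + 1))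
  rw [Real.exp_le_exp]
  push_cast
  linarith

set_option maxHeartbeats 800000 in
/-- **The sampler at the standard parameters is `20·2^{-m}`-close to `D_{ℤ, 2ᵇ√π, 0}`.**
[cite: GentryPeikertVaikuntanathan2008, §4.1] -/
theorem tvDist_lawPMF_std_discreteGaussianInt_le (hm : 1 ≤ m) (hb : m + rOf m + 1 ≤ b) :
    (std m b).lawPMF.tvDist (discreteGaussianInt ((2 : ℝ) ^ b * Real.sqrt π) 0) ≤ 20 * ((2 : ℝ) ^ m)⁻¹ := by
  set P := std m b with hP
  set ε : ℝ := ((2 : ℝ) ^ m)⁻¹ with hε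
  have hε0 : 0 < ε := by rw [hε]; positivity
  have hε1 : ε ≤ 1 / 2 := by
    rw [hε, one_div]
    exact inv_anti₀ (by norm_num) (by
      calc (2 : ℝ) = 2 ^ 1 := by norm_num
        _ ≤ 2 ^ m := pow_le_pow_right₀ (by norm_num) hm)
  have hε2 : ((2 : ℝ) ^ (m + 1))⁻¹ = ε / 2 := by rw [hε, pow_succ, mul_inv]; ring
  have hε8 : ((2 : ℝ) ^ (m + 3))⁻¹ = ε / 8 := by rw [hε, pow_add, mul_inv]; ring
  have hb1 : 1 ≤ b := by omega
  -- the small quantities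
  have hh0 : 0 < P.h := P.h_pos
  have hq0 : 0 < P.q := P.q_pos
  have hR0 : 0 < P.R := by rw [hP, R_std]; positivity
  have hh : P.h ≤ ε / 2 := by rw [← hε2]; exact h_std_le m b hb
  have hqR : P.q * P.R ^ 2 = ε / 8 := by rw [← hε8]; exact q_mul_R_sq_std m b
  have hR1 : (1 : ℝ) < P.R := by have := lt_R_std m b; rw [← hP] at this; have : (0:ℝ) ≤ m := Nat.cast_nonneg m; linarith
  have hq : P.q ≤ ε / 8 := by
    rw [← hqR]; refine le_mul_of_one_le_right hq0.le ?_; nlinarith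
  have hp : P.pNone ^ P.J ≤ ε / 2 := by rw [← hε2]; exact pNone_pow_J_std_le m b
  have hp0 : 0 ≤ P.pNone ^ P.J := pow_nonneg P.pNone_nonneg _
  have hpJ : P.pNone ^ P.J < 1 := by linarith
  have heR : 2 * exp (-P.R) ≤ ε := by have := exp_neg_R_std_le m b; rw [← hP, hε2] at this; linarith
  have heR0 : 0 < exp (-P.R) := exp_pos _
  have hsZ : P.sZ = (2 : ℝ) ^ b * Real.sqrt π := by rw [PGParams.sZ, hP, h_std]; field_simp
  -- the general bound
  have hgen := P.tvDist_lawPMF_discreteGaussianInt_le (one_le_k_std m b) hb1 hpJ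
  rw [hsZ] at hgen
  refine hgen.trans ?_
  -- constants: `2/5 ≤ D₁`, `√π ≤ 1.78`
  have hD1 := P.two_fifths_le hb1
  set D₁ : ℝ := Real.sqrt π - 2 * exp (-P.R) - P.h with hD1def
  have hsp : Real.sqrt π ≤ 1.78 := by
    rw [Real.sqrt_le_left (by norm_num)]
    have := Real.pi_lt_d2; nlinarith
  have hsp0 : 0 ≤ Real.sqrt π := Real.sqrt_nonneg _
  -- (1) the exponential factor
  set x : ℝ := 2 * P.q * P.R ^ 2 + P.q with hx
  have hx0 : 0 ≤ x := by rw [hx]; positivity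
  have hxε : x ≤ 3 * ε / 8 := by rw [hx]; nlinarith
  have hex : exp x ≤ 1 + 3 * ε / 4 := (exp_le_one_add_two_mul hx0 (by linarith)).trans (by linarith)
  have hex0 : 0 < exp x := exp_pos _
  -- (2) `F - 1 ≤ 16 ε`
  have hden : 0 < 1 - P.pNone ^ P.J := by linarith
  have hF : exp x * (Real.sqrt π + P.h) / ((1 - P.pNone ^ P.J) * D₁) - 1 ≤ 16 * ε := by
    rw [div_sub_one (mul_pos hden (by linarith)).ne', div_le_iff₀ (mul_pos hden (by linarith))]
    -- numerator ≤ 4.6 ε, denominator ≥ 0.3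
    have hnum : exp x * (Real.sqrt π + P.h) - (1 - P.pNone ^ P.J) * D₁ ≤ 5 * ε := by
      have heq : exp x * (Real.sqrt π + P.h) - (1 - P.pNone ^ P.J) * D₁ =
          (exp x - 1 + P.pNone ^ P.J) * Real.sqrt π + (exp x + 1 - P.pNone ^ P.J) * P.h + 2 * exp (-P.R) * (1 - P.pNone ^ P.J) := by
        rw [hD1def]; ring
      rw [heq]
      have hA1 : 1 ≤ exp x := Real.one_le_exp hx0
      have t1 : (exp x - 1 + P.pNone ^ P.J) * Real.sqrt π ≤ (5 / 4 * ε) * 1.78 :=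
        mul_le_mul (by linarith) hsp hsp0 (by positivity)
      have t2 : (exp x + 1 - P.pNone ^ P.J) * P.h ≤ (5 / 2) * (ε / 2) :=
        mul_le_mul (by linarith) hh hh0.le (by norm_num)
      have t3 : 2 * exp (-P.R) * (1 - P.pNone ^ P.J) ≤ ε * 1 :=
        mul_le_mul heR (by linarith) hden.le hε0.le
      linarith
    have hdenom : 3 / 10 ≤ (1 - P.pNone ^ P.J) * D₁ := by nlinarith
    nlinarith [mul_le_mul_of_nonneg_left hdenom (show (0:ℝ) ≤ 16 * ε by positivity)]
  -- (3) the tail `≤ 3 ε`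
  have hRh : 7 / 4 ≤ P.R - P.h := by
    have : (2 : ℝ) ≤ P.R := by
      have := lt_R_std m b; rw [← hP] at this
      have hm' : (1 : ℝ) ≤ m := by exact_mod_cast hm
      linarith
    linarith
  have htail : 2 * exp (-(P.R - P.h) ^ 2) / ((P.R - P.h) * D₁) ≤ 3 * ε := by
    have hRh1 : 1 ≤ P.R - P.h := by linarith
    have h1 : exp (-(P.R - P.h) ^ 2) ≤ exp (-(P.R - P.h)) := by
      refine Real.exp_le_exp.2 (neg_le_neg ?_)
      calc P.R - P.h = (P.R - P.h) * 1 := (mul_one _).symm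
        _ ≤ (P.R - P.h) * (P.R - P.h) := mul_le_mul_of_nonneg_left hRh1 (by linarith)
        _ = (P.R - P.h) ^ 2 := (sq _).symm
    have h2 : exp (-(P.R - P.h)) ≤ exp (1 / 4) * exp (-P.R) := by
      rw [← Real.exp_add]
      refine Real.exp_le_exp.2 ?_
      have hh4 : P.h ≤ 1 / 4 := by linarith
      linarith
    have h3 : exp (1 / 4 : ℝ) ≤ 3 / 2 := (exp_le_one_add_two_mul (by norm_num) (by norm_num)).trans (by norm_num)
    have h4 : exp (-(P.R - P.h) ^ 2) ≤ 3 / 4 * ε :=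
      calc exp (-(P.R - P.h) ^ 2) ≤ exp (1 / 4) * exp (-P.R) := h1.trans h2
        _ ≤ 3 / 2 * (ε / 2) := mul_le_mul h3 (by linarith) heR0.le (by norm_num)
        _ = 3 / 4 * ε := by ring
    rw [div_le_iff₀ (mul_pos (by linarith) (by linarith))]
    have h5 : (7 / 4 : ℝ) * (2 / 5) ≤ (P.R - P.h) * D₁ := mul_le_mul hRh hD1 (by norm_num) (by linarith)
    nlinarith [mul_le_mul_of_nonneg_left h5 (show (0:ℝ) ≤ 3 * ε by positivity)]
  linarith

end PGParams

end Literature.Probability.Distributions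

end
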